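import Summits.NavierStokesRegularity.FunctionalMining.NoGo.LogDoorBackground
import HarnessLib

/-!
# The log-door background, II: the lifted field `G_n = (∂_yψ_n η, −∂_xψ_n η, 0)` on `ℝ³`

Search for candidate a priori estimates; no regularity claim. NS FUNCTIONAL MINING — NO-GO BRANCH
(cell `pub-nsfunc`, prove seat gen 3). With `ψ_n(x,y) = x y H_n(x² + y²)` (`NoGo/LogDoorBackground.lean`)
and a `z`-profile `η`:
`background n η = ((x H_n + 2xy² H_n') η(z), −(y H_n + 2x²y H_n') η(z), 0)` (`UG`, `H_n, H_n'` at
`q = x² + y²`). Proved here: smoothness, the full derivative (`hasFDerivAt_UG_zero/one`), divergence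
zero (`background_trace`), the three vorticity entries
`∂₀G₁ − ∂₁G₀ = −η · xy(12H_n' + 4qH_n'')`, `∂₀G₂ − ∂₂G₀ = −(xH_n + 2xy²H_n') η'`,
`∂₁G₂ − ∂₂G₁ = (yH_n + 2x²yH_n') η'` and their UNIFORM-IN-`n` bounds (`background_vorticity_bound`),
vanishing off the unit cylinder, and `G_n = strain n η` on the core `4ⁿ(x²+y²) < 2`
(`background_eq_strain_of_core`). Folklore calculus; nothing is asserted about Navier–Stokes.
-/

open MeasureTheory Set Function Filter
open scoped ContDiff Topology

namespace Summit.NavierStokesRegularity.FunctionalMining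

namespace Sep3

/-- `∞ ≠ 0` in `WithTop ℕ∞`. [folklore] -/
private theorem infty_ne_zero₅ : (∞ : WithTop ℕ∞) ≠ 0 := by simp

/-- The coordinate form `y ↦ yᵢ` on `ℝ³`. [folklore] -/
noncomputable def crd3 (i : Fin 3) : E3 →L[ℝ] ℝ := EuclideanSpace.proj i

/-- `crd3 i v = v i`. [folklore] -/
@[simp] theorem crd3_apply (i : Fin 3) (v : E3) : crd3 i v = v i := rfl

/-- The coordinates are their own derivatives. [folklore] -/
theorem hasFDerivAt_crd3 (i : Fin 3) (y : E3) : HasFDerivAt (fun z : E3 => z i) (crd3 i) y :=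
  (crd3 i).hasFDerivAt

/-- The planar radius squared `Q(y) = y₀² + y₁²`. [folklore] -/
noncomputable def Qr (y : E3) : ℝ := y 0 ^ 2 + y 1 ^ 2

/-- `0 ≤ Q`. [folklore] -/
theorem Qr_nonneg (y : E3) : 0 ≤ Qr y := by unfold Qr; positivity

/-- `2|y₀ y₁| ≤ Q(y)`. [folklore] -/
theorem two_mul_abs_mul_le_Qr (y : E3) : 2 * |y 0 * y 1| ≤ Qr y := by
  unfold Qr
  rw [abs_mul]
  nlinarith [sq_nonneg (|y 0| - |y 1|), sq_abs (y 0), sq_abs (y 1)]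

/-- `|y₀| ≤ √Q`, `|y₁| ≤ √Q`. [folklore] -/
theorem abs_le_sqrt_Qr (y : E3) : |y 0| ≤ Real.sqrt (Qr y) ∧ |y 1| ≤ Real.sqrt (Qr y) := by
  constructor
  · rw [← Real.sqrt_sq_eq_abs]; exact Real.sqrt_le_sqrt (by unfold Qr; nlinarith)
  · rw [← Real.sqrt_sq_eq_abs]; exact Real.sqrt_le_sqrt (by unfold Qr; nlinarith)

/-- `DQ(y) = 2y₀ dy₀ + 2y₁ dy₁`. [folklore] -/
theorem hasFDerivAt_Qr (y : E3) : HasFDerivAt Qr ((2 * y 0) • crd3 0 + (2 * y 1) • crd3 1) y := by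
  have h := ((hasFDerivAt_crd3 0 y).pow 2).add ((hasFDerivAt_crd3 1 y).pow 2)
  refine h.congr_fderiv ?_
  ext v
  simp

/-- `Q` is smooth. [folklore] -/
theorem contDiff_Qr : ContDiff ℝ ∞ Qr := by unfold Qr; fun_prop

variable (n : ℕ) (η : ℝ → ℝ)

/-- Components of the background `G_n`: `((xH + 2xy²H')η, −(yH + 2x²yH')η, 0)` with `H = H_n`,
`H' = H_n'` evaluated at `Q = x² + y²`. [folklore] -/
noncomputable def UG : Fin 3 → E3 → ℝ :=
  ![fun y => (y 0 * coreH n (Qr y) + 2 * y 0 * y 1 ^ 2 * deriv (coreH n) (Qr y)) * η (y 2),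
    fun y => -((y 1 * coreH n (Qr y) + 2 * y 0 ^ 2 * y 1 * deriv (coreH n) (Qr y)) * η (y 2)),
    fun _ => 0]

/-- The background field `G_n` on `ℝ³`. [folklore] -/
noncomputable def background : E3 → E3 := vec3 (UG n η)

/-- Component `0`. [folklore] -/
theorem UG_zero_apply (y : E3) :
    UG n η 0 y = (y 0 * coreH n (Qr y) + 2 * y 0 * y 1 ^ 2 * deriv (coreH n) (Qr y)) * η (y 2) := rfl
/-- Component `1`. [folklore] -/
theorem UG_one_apply (y : E3) :
    UG n η 1 y = -((y 1 * coreH n (Qr y) + 2 * y 0 ^ 2 * y 1 * deriv (coreH n) (Qr y)) * η (y 2)) := rfl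
/-- Component `2`. [folklore] -/
theorem UG_two : UG n η 2 = fun _ => 0 := rfl

variable {n η}

/-- The components of `G_n` are smooth. [folklore] -/
theorem contDiff_UG (hη : ContDiff ℝ ∞ η) (i : Fin 3) : ContDiff ℝ ∞ (UG n η i) := by
  have hH : ContDiff ℝ ∞ (fun y : E3 => coreH n (Qr y)) := (coreH_contDiff n).comp contDiff_Qr
  have hH' : ContDiff ℝ ∞ (fun y : E3 => deriv (coreH n) (Qr y)) :=
    (contDiff_deriv_coreH n).1.comp contDiff_Qr
  have hηc : ContDiff ℝ ∞ (fun y : E3 => η (y 2)) := hη.comp (crd3 2).contDiff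
  have h0 : ContDiff ℝ ∞ (fun y : E3 => y 0) := (crd3 0).contDiff
  have h1 : ContDiff ℝ ∞ (fun y : E3 => y 1) := (crd3 1).contDiff
  obtain rfl | rfl | rfl : i = 0 ∨ i = 1 ∨ i = 2 := by fin_cases i <;> simp
  · exact ((h0.mul hH).add (((contDiff_const.mul h0).mul (h1.pow 2)).mul hH')).mul hηc
  · exact (((h1.mul hH).add (((contDiff_const.mul (h0.pow 2)).mul h1).mul hH')).mul hηc).neg
  · exact contDiff_const

/-- `G_n` is smooth. [folklore] -/
theorem contDiff_background (hη : ContDiff ℝ ∞ η) : ContDiff ℝ ∞ (background n η) :=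
  contDiff_vec3 (contDiff_UG hη)

/-- The components of `G_n` are differentiable. [folklore] -/
theorem differentiable_UG (hη : ContDiff ℝ ∞ η) (i : Fin 3) : Differentiable ℝ (UG n η i) :=
  (contDiff_UG hη i).differentiable infty_ne_zero₅

section Deriv

variable (hη : ContDiff ℝ ∞ η) (y : E3)

/-- Chain rule for `H_n ∘ Q`. [folklore] -/
theorem hasFDerivAt_coreH_Qr :
    HasFDerivAt (fun z : E3 => coreH n (Qr z))
      (deriv (coreH n) (Qr y) • ((2 * y 0) • crd3 0 + (2 * y 1) • crd3 1)) y :=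
  (((coreH_contDiff n).differentiable infty_ne_zero₅ _).hasDerivAt).comp_hasFDerivAt y (hasFDerivAt_Qr y)

/-- Chain rule for `H_n' ∘ Q`. [folklore] -/
theorem hasFDerivAt_deriv_coreH_Qr :
    HasFDerivAt (fun z : E3 => deriv (coreH n) (Qr z))
      (deriv (deriv (coreH n)) (Qr y) • ((2 * y 0) • crd3 0 + (2 * y 1) • crd3 1)) y :=
  (((contDiff_deriv_coreH n).1.differentiable infty_ne_zero₅ _).hasDerivAt).comp_hasFDerivAt y
    (hasFDerivAt_Qr y)

include hη in
/-- Chain rule for `η(y₂)`. [folklore] -/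
theorem hasFDerivAt_eta : HasFDerivAt (fun z : E3 => η (z 2)) (deriv η (y 2) • crd3 2) y :=
  ((hη.differentiable infty_ne_zero₅ _).hasDerivAt).comp_hasFDerivAt y (hasFDerivAt_crd3 2 y)

include hη in
/-- **`D G₀`**: with `H, H', H''` at `Q(y)`, `x = y₀`, `y = y₁`, `z = y₂`:
`∂₀G₀ = (H + 2x²H' + 2y²H' + 4x²y²H'')η`, `∂₁G₀ = (6xyH' + 4xy³H'')η`, `∂₂G₀ = (xH + 2xy²H')η'`.
[folklore] -/
theorem fderiv_UG_zero (v : E3) :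
    fderiv ℝ (UG n η 0) y v =
      v 0 * ((coreH n (Qr y) + 2 * y 0 ^ 2 * deriv (coreH n) (Qr y) + 2 * y 1 ^ 2 * deriv (coreH n) (Qr y)
        + 4 * y 0 ^ 2 * y 1 ^ 2 * deriv (deriv (coreH n)) (Qr y)) * η (y 2)) +
      v 1 * ((6 * y 0 * y 1 * deriv (coreH n) (Qr y) + 4 * y 0 * y 1 ^ 3 * deriv (deriv (coreH n)) (Qr y))
        * η (y 2)) +
      v 2 * ((y 0 * coreH n (Qr y) + 2 * y 0 * y 1 ^ 2 * deriv (coreH n) (Qr y)) * deriv η (y 2)) := by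
  have hx := hasFDerivAt_crd3 0 y
  have hy := hasFDerivAt_crd3 1 y
  have hH := hasFDerivAt_coreH_Qr (n := n) y
  have hH' := hasFDerivAt_deriv_coreH_Qr (n := n) y
  have he := hasFDerivAt_eta hη y
  have h := ((hx.mul hH).add ((((hx.const_mul (2 : ℝ)).mul (hy.pow 2))).mul hH')).mul he
  have h' : HasFDerivAt (UG n η 0) _ y := h
  rw [h'.fderiv]
  simp only [add_apply, smul_apply, crd3_apply, smul_eq_mul,
    Pi.mul_apply, Pi.add_apply, nsmul_eq_mul, Nat.cast_ofNat, pow_one, Nat.add_one_sub_one]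
  ring

include hη in
/-- **`D G₁`**: `∂₀G₁ = −(6xyH' + 4x³yH'')η`, `∂₁G₁ = −(H + 2y²H' + 2x²H' + 4x²y²H'')η`,
`∂₂G₁ = −(yH + 2x²yH')η'`. [folklore] -/
theorem fderiv_UG_one (v : E3) :
    fderiv ℝ (UG n η 1) y v =
      -(v 0 * ((6 * y 0 * y 1 * deriv (coreH n) (Qr y) + 4 * y 0 ^ 3 * y 1 * deriv (deriv (coreH n)) (Qr y))
          * η (y 2)) +
        v 1 * ((coreH n (Qr y) + 2 * y 1 ^ 2 * deriv (coreH n) (Qr y) + 2 * y 0 ^ 2 * deriv (coreH n) (Qr y)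
          + 4 * y 0 ^ 2 * y 1 ^ 2 * deriv (deriv (coreH n)) (Qr y)) * η (y 2)) +
        v 2 * ((y 1 * coreH n (Qr y) + 2 * y 0 ^ 2 * y 1 * deriv (coreH n) (Qr y)) * deriv η (y 2))) := by
  have hx := hasFDerivAt_crd3 0 y
  have hy := hasFDerivAt_crd3 1 y
  have hH := hasFDerivAt_coreH_Qr (n := n) y
  have hH' := hasFDerivAt_deriv_coreH_Qr (n := n) y
  have he := hasFDerivAt_eta hη y
  have h := (((hy.mul hH).add ((((hx.pow 2).const_mul (2 : ℝ)).mul hy).mul hH')).mul he).neg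
  have h' : HasFDerivAt (UG n η 1) _ y := h
  rw [h'.fderiv]
  simp only [neg_apply, add_apply, smul_apply, crd3_apply, smul_eq_mul, Pi.mul_apply, Pi.add_apply,
    nsmul_eq_mul, Nat.cast_ofNat, pow_one, Nat.add_one_sub_one]
  ring

/-- `D G₂ = 0`. [folklore] -/
theorem fderiv_UG_two (v : E3) : fderiv ℝ (UG n η 2) y v = 0 := by
  rw [UG_two, (hasFDerivAt_const (0 : ℝ) y).fderiv]; simp

end Deriv

/-- **`G_n` is divergence free.** [folklore] -/
theorem background_trace (hη : ContDiff ℝ ∞ η) (y : E3) :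
    LinearMap.trace ℝ E3 (fderiv ℝ (background n η) y : E3 →ₗ[ℝ] E3) = 0 := by
  rw [background, trace_fderiv_vec3 (differentiable_UG hη), fderiv_UG_zero hη, fderiv_UG_one hη,
    fderiv_UG_two]
  simp only [PiLp.single_apply]
  simp
  ring

/-! ## Vorticity entries and their uniform bound -/

/-- `∂₀G₁ − ∂₁G₀ = −η · (y₀y₁)(12H' + 4QH'')`. [folklore] -/
theorem background_curl01 (hη : ContDiff ℝ ∞ η) (y : E3) :
    fderiv ℝ (UG n η 1) y (EuclideanSpace.single 0 1) - fderiv ℝ (UG n η 0) y (EuclideanSpace.single 1 1) =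
      -(η (y 2) * (y 0 * y 1 * (12 * deriv (coreH n) (Qr y) + 4 * Qr y * deriv (deriv (coreH n)) (Qr y)))) := by
  rw [fderiv_UG_zero hη, fderiv_UG_one hη]
  simp only [PiLp.single_apply]
  simp [Qr]
  ring

/-- `∂₀G₂ − ∂₂G₀ = −(y₀H + 2y₀y₁²H') η'`. [folklore] -/
theorem background_curl02 (hη : ContDiff ℝ ∞ η) (y : E3) :
    fderiv ℝ (UG n η 2) y (EuclideanSpace.single 0 1) - fderiv ℝ (UG n η 0) y (EuclideanSpace.single 2 1) =
      -((y 0 * coreH n (Qr y) + 2 * y 0 * y 1 ^ 2 * deriv (coreH n) (Qr y)) * deriv η (y 2)) := by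
  rw [fderiv_UG_zero hη, fderiv_UG_two]
  simp only [PiLp.single_apply]
  simp

/-- `∂₁G₂ − ∂₂G₁ = (y₁H + 2y₀²y₁H') η'`. [folklore] -/
theorem background_curl12 (hη : ContDiff ℝ ∞ η) (y : E3) :
    fderiv ℝ (UG n η 2) y (EuclideanSpace.single 1 1) - fderiv ℝ (UG n η 1) y (EuclideanSpace.single 2 1) =
      (y 1 * coreH n (Qr y) + 2 * y 0 ^ 2 * y 1 * deriv (coreH n) (Qr y)) * deriv η (y 2) := by
  rw [fderiv_UG_one hη, fderiv_UG_two]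
  simp only [PiLp.single_apply]
  simp

/-- Planar vorticity bound: `|y₀y₁(12H' + 4QH'')| ≤ 24B₁ + 32B₂` uniformly in `n`. [folklore] -/
theorem abs_planarVorticity_le (n : ℕ) {B₁ B₂ : ℝ} (hB₁ : 0 ≤ B₁) (hB₂ : 0 ≤ B₂)
    (hb1 : ∀ s, |iteratedDeriv 1 stepB s| ≤ B₁) (hb2 : ∀ s, |iteratedDeriv 2 stepB s| ≤ B₂) (y : E3) :
    |y 0 * y 1 * (12 * deriv (coreH n) (Qr y) + 4 * Qr y * deriv (deriv (coreH n)) (Qr y))| ≤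
      24 * B₁ + 32 * B₂ := by
  have hq := Qr_nonneg y
  have h1 := abs_mul_deriv_coreH_le n hB₁ hb1 hq
  have h2 := abs_sq_mul_deriv2_coreH_le n hB₂ hb2 hq
  have hxy := two_mul_abs_mul_le_Qr y
  set P : ℝ := y 0 * y 1 with hP
  set D1 : ℝ := deriv (coreH n) (Qr y) with hD1
  set D2 : ℝ := deriv (deriv (coreH n)) (Qr y) with hD2
  -- `|P (12 D1 + 4 Q D2)| ≤ 6 |Q D1| + 2 |Q² D2|` using `2|P| ≤ Q`
  have e : P * (12 * D1 + 4 * Qr y * D2) = 6 * ((2 * P) * D1) + 2 * ((2 * P) * (Qr y * D2)) := by ring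
  rw [e]
  refine (abs_add_le _ _).trans ?_
  have k1' : |2 * P| * |D1| ≤ 4 * B₁ :=
    calc |2 * P| * |D1| ≤ Qr y * |D1| := by
          rw [abs_mul, abs_two]; exact mul_le_mul_of_nonneg_right hxy (abs_nonneg _)
      _ = |Qr y * D1| := by rw [abs_mul, abs_of_nonneg hq]
      _ ≤ 4 * B₁ := h1
  have k1 : |6 * ((2 * P) * D1)| ≤ 6 * (4 * B₁) := by
    rw [abs_mul, show |(6 : ℝ)| = 6 by norm_num, abs_mul]
    exact mul_le_mul_of_nonneg_left k1' (by norm_num)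
  have k2' : |2 * P| * |Qr y * D2| ≤ 16 * B₂ :=
    calc |2 * P| * |Qr y * D2| ≤ Qr y * |Qr y * D2| := by
          rw [abs_mul 2, abs_two]; exact mul_le_mul_of_nonneg_right hxy (abs_nonneg _)
      _ = |Qr y ^ 2 * D2| := by
          rw [abs_mul, abs_mul, abs_of_nonneg hq, abs_of_nonneg (pow_nonneg hq 2)]; ring
      _ ≤ 16 * B₂ := h2
  have k2 : |2 * ((2 * P) * (Qr y * D2))| ≤ 2 * (16 * B₂) := by
    rw [abs_mul, abs_two, abs_mul]
    exact mul_le_mul_of_nonneg_left k2' (by norm_num)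
  linarith

/-- Gradient-of-stream-function bound: `|y₀H + 2y₀y₁²H'| ≤ 2 + 8B₁` uniformly in `n` (and the
same for `|y₁H + 2y₀²y₁H'|`). [folklore] -/
theorem abs_streamGrad_le (n : ℕ) {B₁ : ℝ} (hB₁ : 0 ≤ B₁) (hb1 : ∀ s, |iteratedDeriv 1 stepB s| ≤ B₁)
    (y : E3) :
    |y 0 * coreH n (Qr y) + 2 * y 0 * y 1 ^ 2 * deriv (coreH n) (Qr y)| ≤ 2 + 8 * B₁ ∧
      |y 1 * coreH n (Qr y) + 2 * y 0 ^ 2 * y 1 * deriv (coreH n) (Qr y)| ≤ 2 + 8 * B₁ := by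
  have hq := Qr_nonneg y
  have hH := sqrt_mul_coreH_le n hq
  have hH0 := coreH_nonneg n (Qr y)
  have h1 := abs_mul_deriv_coreH_le n hB₁ hb1 hq
  obtain ⟨hx, hy⟩ := abs_le_sqrt_Qr y
  have hsq := Real.sqrt_nonneg (Qr y)
  -- case `Q ≥ 1`: everything vanishes except possibly at `Q = 1` where `H = 0` and `|Q H'| ≤ 4B₁`
  by_cases hQ1 : 1 < Qr y
  · obtain ⟨hd, -⟩ := deriv_coreH_eq_zero n (Or.inr hQ1)
    rw [coreH_eq_zero_of_one_le n hQ1.le, hd]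
    simp
    positivity
  · push Not at hQ1
    have hsq1 : Real.sqrt (Qr y) ≤ 1 := Real.sqrt_le_one.mpr hQ1 |>.trans_eq rfl
    -- `|x H| ≤ √Q H ≤ 2`, `|2 x y² H'| ≤ 2 √Q · Q |H'| ≤ 8 B₁` (as `√Q ≤ 1`)
    have a1 : |y 0 * coreH n (Qr y)| ≤ 2 := by
      rw [abs_mul, abs_of_nonneg hH0]
      exact (mul_le_mul_of_nonneg_right hx hH0).trans hH
    have a1' : |y 1 * coreH n (Qr y)| ≤ 2 := by
      rw [abs_mul, abs_of_nonneg hH0]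
      exact (mul_le_mul_of_nonneg_right hy hH0).trans hH
    have hy2 : y 1 ^ 2 ≤ Qr y := by unfold Qr; nlinarith
    have hx2 : y 0 ^ 2 ≤ Qr y := by unfold Qr; nlinarith
    have a2 : |2 * y 0 * y 1 ^ 2 * deriv (coreH n) (Qr y)| ≤ 8 * B₁ := by
      rw [show 2 * y 0 * y 1 ^ 2 * deriv (coreH n) (Qr y) = 2 * y 0 * (y 1 ^ 2 * deriv (coreH n) (Qr y))
        by ring, abs_mul, abs_mul, abs_two]
      have : |y 1 ^ 2 * deriv (coreH n) (Qr y)| ≤ |Qr y * deriv (coreH n) (Qr y)| := by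
        rw [abs_mul, abs_mul, abs_of_nonneg (sq_nonneg _), abs_of_nonneg hq]
        exact mul_le_mul_of_nonneg_right hy2 (abs_nonneg _)
      calc 2 * |y 0| * |y 1 ^ 2 * deriv (coreH n) (Qr y)| ≤ 2 * 1 * (4 * B₁) := by
            apply mul_le_mul (by linarith [hx.trans hsq1]) (this.trans h1) (abs_nonneg _) (by norm_num)
        _ = 8 * B₁ := by ring
    have a2' : |2 * y 0 ^ 2 * y 1 * deriv (coreH n) (Qr y)| ≤ 8 * B₁ := by
      rw [show 2 * y 0 ^ 2 * y 1 * deriv (coreH n) (Qr y) = 2 * y 1 * (y 0 ^ 2 * deriv (coreH n) (Qr y))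
        by ring, abs_mul, abs_mul, abs_two]
      have : |y 0 ^ 2 * deriv (coreH n) (Qr y)| ≤ |Qr y * deriv (coreH n) (Qr y)| := by
        rw [abs_mul, abs_mul, abs_of_nonneg (sq_nonneg _), abs_of_nonneg hq]
        exact mul_le_mul_of_nonneg_right hx2 (abs_nonneg _)
      calc 2 * |y 1| * |y 0 ^ 2 * deriv (coreH n) (Qr y)| ≤ 2 * 1 * (4 * B₁) := by
            apply mul_le_mul (by linarith [hy.trans hsq1]) (this.trans h1) (abs_nonneg _) (by norm_num)
        _ = 8 * B₁ := by ring
    exact ⟨(abs_add_le _ _).trans (by linarith), (abs_add_le _ _).trans (by linarith)⟩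

/-! ## Support and the core -/

/-- Off the unit cylinder in the plane (`Q > 1`) the background vanishes. [folklore] -/
theorem UG_eq_zero_of_one_lt {y : E3} (hy : 1 < Qr y) (i : Fin 3) : UG n η i y = 0 := by
  obtain ⟨hd, -⟩ := deriv_coreH_eq_zero n (Or.inr hy)
  obtain rfl | rfl | rfl : i = 0 ∨ i = 1 ∨ i = 2 := by fin_cases i <;> simp
  · rw [UG_zero_apply, coreH_eq_zero_of_one_le n hy.le, hd]; ring
  · rw [UG_one_apply, coreH_eq_zero_of_one_le n hy.le, hd]; ring
  · rfl

/-- Where `η(y₂) = 0` the background vanishes. [folklore] -/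
theorem UG_eq_zero_of_eta {y : E3} (hy : η (y 2) = 0) (i : Fin 3) : UG n η i y = 0 := by
  obtain rfl | rfl | rfl : i = 0 ∨ i = 1 ∨ i = 2 := by fin_cases i <;> simp
  · rw [UG_zero_apply, hy]; ring
  · rw [UG_one_apply, hy]; ring
  · rfl

/-- **On the core `4ⁿ Q(y) < 2` the background IS the linear strain of rate `n`:**
`G_n(y) = n η(y₂) (y₀, −y₁, 0) = strain n η (y)`. [folklore] -/
theorem background_eq_strain_of_core {y : E3} (hy : (4 : ℝ) ^ n * Qr y < 2) :
    background n η y = strain n η y := by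
  have hq := Qr_nonneg y
  obtain ⟨hd, -⟩ := deriv_coreH_eq_zero n (Or.inl ⟨hq, hy⟩)
  have hH := coreH_eq_of_core n hq hy.le
  obtain ⟨e0, e1, e2⟩ := strain_apply (n : ℝ) η y
  ext i
  obtain rfl | rfl | rfl : i = 0 ∨ i = 1 ∨ i = 2 := by fin_cases i <;> simp
  · rw [e0, background, vec3_apply, UG_zero_apply, hH, hd]; ring
  · rw [e1, background, vec3_apply, UG_one_apply, hH, hd]; ring
  · rw [e2, background, vec3_apply]; rfl

end Sep3

end Summit.NavierStokesRegularity.FunctionalMining
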